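import Summits.QuantumAdvantage.AdviceFreeQNC0.TensorBlocksFixed
import Summits.QuantumAdvantage.AdviceFreeQNC0.SPSRingFail
import HarnessLib

/-!
# Cell qa-qnc0 (rung F-Q1, crux α `RingToElim` / density target T10, many-blocks corner): the
# DENSITY-AXIS PAYOFF CHAIN in one line (planner qa-qnc0-p1 Sketch13 v3 `DensityAxisPayoff`)

`BlockSplitFixed 1 → TensorMultOneAt → SPSApprox → SPSRingFailPoly` — every arrow is a theorem of the
tree: `blockSplitFixed` / `multOneAtPays` (`TensorBlocksFixed.lean`), `b10W` (qn-lit, `SPSWalkPayoff.lean`),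
`b10R` (qn-prover, `SPSRingFail.lean`), `spsApprox` (qn-lit, `SPSApprox.lean`).  Hence

* `densityAxisPayoff : DensityAxisPayoff` (Sketch13 v3 statement VERBATIM), and
* `spsRingFailPoly_of_tensorMultOneAt : TensorMultOneAt → SPSRingFailPoly` — the advice-free,
  non-interactive `QNC⁰ ⊄ ΣΠΣ_𝔽₂(poly)` separation with inverse-polynomial soundness gap hangs on the
  crux of record MULT₁-at-one-block-size ALONE (`TensorMultOneAt`: some block size `m` and ratio
  `β > 1/4` with `#FAIL ≥ (β·2^m)^k` uniformly in `k` for the degree-`1` even-triple sum code).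

WHAT THIS IS NOT: `TensorMultOneAt` is OPEN (a finite-code integrality statement; LP never pays,
ROUND-12 §2.7(a)); nothing on α; separation NOT moved.
-/

noncomputable section

namespace Summit.QuantumAdvantage.AdviceFreeQNC0

open Finset
open Literature.Computability.MetaComplexity Literature.Computability.MetaComplexity.Smolensky

/-- The payoff chain of the density axis in one line (all arrows typed in Sketch13 v1–v3):
`BlockSplitFixed 1 → TensorMultOneAt → T10W → (SPSApprox → SPSWalkFailPoly → SPSRingFailPoly)`.
(Planner qa-qnc0-p1 Sketch13 v3, verbatim.) -/
def DensityAxisPayoff : Prop :=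
  BlockSplitFixed 1 → TensorMultOneAt → SPSApprox → SPSRingFailPoly

/-- **`DensityAxisPayoff` — PROVED** (composition of `multOneAtPays`, `b10W`, `b10R`). -/
theorem densityAxisPayoff : DensityAxisPayoff :=
  fun hBS hM hA => spsRingFailPoly_of_t10W (multOneAtPays hBS hM) hA

/-- **Unconditional in everything but MULT₁ at one block size**: `TensorMultOneAt → SPSRingFailPoly`
(`blockSplitFixed 1` and `spsApprox` are theorems of the tree). -/
theorem spsRingFailPoly_of_tensorMultOneAt (hM : TensorMultOneAt) : SPSRingFailPoly :=
  spsRingFailPoly_of_t10W (t10W_of_tensorMultOneAt hM) spsApprox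

end Summit.QuantumAdvantage.AdviceFreeQNC0
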